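import Summits.ResolutionOfSingularities.ResolutionOfSingularities.Theorems.EquisingularLiftEquisingularLiftLinearCentreComap
import Summits.ResolutionOfSingularities.ResolutionOfSingularities.Theorems.EquisingularLiftEquisingularLiftStrictTransformBlowupModel
import HarnessLib

/-!
# `EquisingularLift` (stmt-ResolutionOfSingularities-15660), line `Sketch` v10b — assembly of
# `stub_linearCentre_of_blowupModel` from a re-embedding with prescribed home-chart ideals

[OURS · L1 W4.5b] Helper for the registered stub `stub_linearCentre_of_blowupModel` of the crux `EquisingularLift`
(skeleton v10b, lead `res-L1-w45b-lead-1`); NOT a statement of any manuscript. AI-produced, weaker than expert review.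

The stub asks, for an integral `H ⊆ ℙⁿ_k` with a regular blow-up model `𝔞 ≠ 0`, for a closed immersion
`j : H → ℙ^{r+m}_k` and the coordinate linear centre `Λ = ker (Proj f)` (`f` the graded surjection killing the last `m`
variables) with `j(H) ⊄ Λ` and all reduced strict transforms of `j(H)` under blow-ups along `Λ` regular. This file
reduces it to the RE-EMBEDDING INTERFACE of the line (pieces (A) Serre generators + (B) closed immersion by sections,
workers `stub-3`/`stub-4`): a closed immersion `j` together with a family of affine charts `H_i = j⁻¹ D₊(x_i)` (`i ∈ S`)
covering `H` on which `𝔞(H_i)` is spanned by the pulled-back coordinates `j^*(x_a/x_i) = GeneratingSections.homRatio j i a`,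
`r + 1 ≤ a`.

* `isLocallyNoetherian_proj` — `ℙ^N_k` is locally Noetherian (`k` a field);
* `linearCentre_of_charts` — from such `(j, S)` and the regular blow-up model: the kill map `f` exists
  (`LinearCentre.exists_kill`), `Λ · 𝒪_H = 𝔞` (`comap_ker_kill_eq_of_charts`, piece (C)), hence `j(H) ⊄ Λ`
  (`not_range_subset_support_of_comap_eq`) and every reduced strict transform is regular
  (`isRegular_reducedStrictTransform_of_blowupModel`, the lead's piece (i) over p167331 / Hartshorne II.7.15);
* `linearCentre_of_blowupModel_of_reembedding` — the registered stub `stub_linearCentre_of_blowupModel` (conclusion =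
  its signature verbatim) from the re-embedding interface stated as a hypothesis.

References: [Hartshorne1977, II Prop. 5.9, Thm. 7.1, Cor. 7.15]; [GortzWedhorn2020, Example 4.36].
-/

set_option linter.dupNamespace false -- mandated namespace `Summit.<Summit>.<Problem>` of this single-conjunct summit

noncomputable section

open CategoryTheory CategoryTheory.Limits AlgebraicGeometry TopologicalSpace
open MvPolynomial HomogeneousLocalization
open Literature.AlgebraicGeometry.Resolution
open Literature.AlgebraicGeometry.Motives Literature.AlgebraicGeometry.Motives.Segre
open AlgebraicGeometry.Scheme.IdealSheafData

attribute [local instance] MvPolynomial.gradedAlgebra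

namespace Summit.ResolutionOfSingularities.ResolutionOfSingularities.Cruxes.EquisingularLift.StrataSplit

namespace LinearCentre

/-! ## Assembly: the data of `stub_linearCentre_of_blowupModel` from a re-embedding with prescribed home-chart ideals -/

section Assembly

open Literature.AlgebraicGeometry.Motives (projectiveSpace)

/-- `ℙ^{N}_k` (as `Proj k[x_0..x_N]`) is locally Noetherian for a field `k` (finite type over `Spec k`). [folklore] -/
theorem isLocallyNoetherian_proj (k : Type) [Field k] (N : ℕ) :
    IsLocallyNoetherian (Proj (homogeneousSubmodule (Fin (N + 1)) k)) := by
  haveI := (stub_projectiveAmbientSmoothProper k N).2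
  exact LocallyOfFiniteType.isLocallyNoetherian
    (Proj.toSpecZero (homogeneousSubmodule (Fin (N + 1)) k) ≫
      Spec.map (CommRingCat.ofHom (algebraMap k ((homogeneousSubmodule (Fin (N + 1)) k) 0))))

/-- **Assembly of the linear-centre data from charts.** Let `H` be integral with a regular blow-up model `𝔞 ≠ 0`
(every blow-up of `𝔞` regular), and `j : H → ℙ^{r+m}_k` a closed immersion such that on a covering family of charts
`H_i = j⁻¹ D₊(x_i)` (`i ∈ S`) the ideal of `𝔞` is spanned by the `j^*(x_a/x_i)`, `r + 1 ≤ a`. Then, for the kill map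
`f` (which exists, `exists_kill`) and `Λ = ker (Proj f)`: `Λ · 𝒪_H = 𝔞` (`comap_ker_kill_eq_of_charts`), so `j(H) ⊄ Λ`
(`not_range_subset_support_of_comap_eq`) and the reduced strict transform of `j(H)` under every blow-up along `Λ` is
regular (`isRegular_reducedStrictTransform_of_blowupModel`, p167331 / Hartshorne II.7.15) — exactly the `∃`-block of
`stub_linearCentre_of_blowupModel` for this `r, m, j`. [OURS · L1 W4.5b] -/
theorem linearCentre_of_charts {k : Type} [Field k] {H : Scheme.{0}} [IsIntegral H] {r m : ℕ}
    (j : H ⟶ Proj (homogeneousSubmodule (Fin (r + m + 1)) k)) [IsClosedImmersion j]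
    {𝔞 : H.IdealSheafData} (h𝔞 : 𝔞 ≠ ⊥)
    (hBM : ∀ (Z : Scheme.{0}) (π : Z ⟶ H), IsBlowup π 𝔞 → Scheme.IsRegular Z)
    (S : Set (Fin (r + m + 1)))
    (hV : ∀ i ∈ S, IsAffineOpen (j ⁻¹ᵁ Proj.basicOpen (homogeneousSubmodule (Fin (r + m + 1)) k) (X i)))
    (hcov : ⨆ i : S, j ⁻¹ᵁ Proj.basicOpen (homogeneousSubmodule (Fin (r + m + 1)) k) (X (i : Fin (r + m + 1))) = ⊤)
    (hS : ∀ (i : Fin (r + m + 1)) (hi : i ∈ S),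
      𝔞.ideal ⟨j ⁻¹ᵁ Proj.basicOpen (homogeneousSubmodule (Fin (r + m + 1)) k) (X i), hV i hi⟩ =
        Ideal.span (Set.range fun a : {a : Fin (r + m + 1) // r + 1 ≤ (a : ℕ)} =>
          GeneratingSections.homRatio j i a.1)) :
    ∃ (fk : homogeneousSubmodule (Fin (r + m + 1)) k →+*ᵍ homogeneousSubmodule (Fin (r + 1)) k)
      (hfk' : HomogeneousIdeal.irrelevant (homogeneousSubmodule (Fin (r + 1)) k) ≤
        (HomogeneousIdeal.irrelevant (homogeneousSubmodule (Fin (r + m + 1)) k)).map fk),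
      (∀ a : k, fk (C a) = C a) ∧
      (∀ i : Fin (r + m + 1), fk (X i) = if h : (i : ℕ) < r + 1 then X ⟨i, h⟩ else 0) ∧
      IsClosedImmersion j ∧
      ¬ (Set.range j ⊆ ((Proj.map fk hfk').ker.support : Set (Proj (homogeneousSubmodule (Fin (r + m + 1)) k)))) ∧
      (∀ (W : Scheme.{0}) (τ₀ : W ⟶ Proj (homogeneousSubmodule (Fin (r + m + 1)) k)),
        IsBlowup τ₀ (Proj.map fk hfk').ker →
          Scheme.IsRegular (vanishingIdeal (⟨closure (τ₀ ⁻¹' (Set.range j \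
            ((Proj.map fk hfk').ker.support : Set (Proj (homogeneousSubmodule (Fin (r + m + 1)) k))))),
            isClosed_closure⟩ : Closeds W)).subscheme) := by
  obtain ⟨fk, hfk', hfkC, hfkX⟩ := exists_kill k r m
  have hcomap : (Proj.map fk hfk').ker.comap j = 𝔞 :=
    comap_ker_kill_eq_of_charts fk hfk' hfkC hfkX j 𝔞 S hV hcov hS
  have hnot : ¬ (Set.range j ⊆ ((Proj.map fk hfk').ker.support : Set (Proj (homogeneousSubmodule (Fin (r + m + 1)) k)))) :=
    not_range_subset_support_of_comap_eq j hcomap h𝔞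
  haveI : IsLocallyNoetherian (Proj (homogeneousSubmodule (Fin (r + m + 1)) k)) := isLocallyNoetherian_proj k (r + m)
  refine ⟨fk, hfk', hfkC, hfkX, inferInstance, hnot, fun W τ₀ hτ₀ => ?_⟩
  refine isRegular_reducedStrictTransform_of_blowupModel j (Proj.map fk hfk').ker hnot ?_ τ₀ hτ₀
  rw [hcomap]
  exact hBM

/-- **`stub_linearCentre_of_blowupModel` from a re-embedding theorem** (the interface of pieces (A) Serre generators +
(B) closed immersion by sections): if every closed subscheme `H ⊆ ℙⁿ_k` with an ideal sheaf `𝔞` re-embeds as a closed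
immersion `j : H → ℙ^{r+m}_k` whose home charts `j⁻¹ D₊(x_i)` (`i ∈ S`) are affine, cover `H`, and carry
`𝔞(H_i) = (j^*(x_a/x_i) : r + 1 ≤ a)`, then the registered stub `stub_linearCentre_of_blowupModel` holds (conclusion =
its signature verbatim), by `linearCentre_of_charts`. [OURS · L1 W4.5b] -/
theorem linearCentre_of_blowupModel_of_reembedding
    (hre : ∀ (k : Type) [Field k] (n : ℕ) (H : AlgebraicGeometry.Scheme.{0})
      (ι : H ⟶ (projectiveSpace n k).left), AlgebraicGeometry.IsClosedImmersion ι → AlgebraicGeometry.IsIntegral H →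
      ∀ (𝔞 : H.IdealSheafData), ∃ (r m : ℕ) (j : H ⟶ Proj (homogeneousSubmodule (Fin (r + m + 1)) k))
        (S : Set (Fin (r + m + 1)))
        (hV : ∀ i ∈ S, IsAffineOpen (j ⁻¹ᵁ Proj.basicOpen (homogeneousSubmodule (Fin (r + m + 1)) k) (X i))),
        AlgebraicGeometry.IsClosedImmersion j ∧
        (⨆ i : S, j ⁻¹ᵁ Proj.basicOpen (homogeneousSubmodule (Fin (r + m + 1)) k) (X (i : Fin (r + m + 1))) = ⊤) ∧
        (∀ (i : Fin (r + m + 1)) (hi : i ∈ S),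
          𝔞.ideal ⟨j ⁻¹ᵁ Proj.basicOpen (homogeneousSubmodule (Fin (r + m + 1)) k) (X i), hV i hi⟩ =
            Ideal.span (Set.range fun a : {a : Fin (r + m + 1) // r + 1 ≤ (a : ℕ)} =>
              GeneratingSections.homRatio j i a.1))) :
    ∀ p : ℕ, p.Prime → ∀ (k : Type) [Field k] [CharP k p] [IsAlgClosed k] (n : ℕ) (H : AlgebraicGeometry.Scheme.{0}) (ι : H ⟶ (Literature.AlgebraicGeometry.Motives.projectiveSpace n k).left), AlgebraicGeometry.IsClosedImmersion ι → AlgebraicGeometry.IsIntegral H → (∀ y : (Literature.AlgebraicGeometry.Motives.projectiveSpace n k).left, ∃ U : (Literature.AlgebraicGeometry.Motives.projectiveSpace n k).left.affineOpens, y ∈ (U : (Literature.AlgebraicGeometry.Motives.projectiveSpace n k).left.Opens) ∧ (ι.ker.ideal U).IsPrincipal) → (∃ 𝔞 : H.IdealSheafData, 𝔞 ≠ ⊥ ∧ ∀ (Z : AlgebraicGeometry.Scheme.{0}) (π : Z ⟶ H), Literature.AlgebraicGeometry.Resolution.IsBlowup π 𝔞 → Literature.AlgebraicGeometry.Resolution.Scheme.IsRegular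 Z) → ∃ (r m : ℕ) (fk : MvPolynomial.homogeneousSubmodule (Fin (r + m + 1)) k →+*ᵍ MvPolynomial.homogeneousSubmodule (Fin (r + 1)) k) (hfk' : HomogeneousIdeal.irrelevant (MvPolynomial.homogeneousSubmodule (Fin (r + 1)) k) ≤ (HomogeneousIdeal.irrelevant (MvPolynomial.homogeneousSubmodule (Fin (r + m + 1)) k)).map fk) (j : H ⟶ AlgebraicGeometry.Proj (MvPolynomial.homogeneousSubmodule (Fin (r + m + 1)) k)), (∀ a : k, fk (MvPolynomial.C a) = MvPolynomial.C a) ∧ (∀ i : Fin (r + m + 1), fk (MvPolynomial.X i) = if h : (i : ℕ) < r + 1 then MvPolynomial.X ⟨i, h⟩ else 0) ∧ AlgebraicGeometry.IsClosedImmersion j ∧ ¬ (Set.range j ⊆ ((AlgebraicGeometry.Proj.map fk hfk').ker.support : Set (AlgebraicGeometry.Proj (MvPolynomial.homogeneousSubmodule (Fin (r + m + 1)) k)))) ∧ (∀ (W : AlgebraicGeometry.Scheme.{0}) (τ₀ : W ⟶ AlgebraicGeometry.Proj (MvPolynomial.homogeneousSubmodule (Fin (r + m + 1)) k)), Literature.AlgebraicGeometry.Resolution.IsBlowup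 τ₀ (AlgebraicGeometry.Proj.map fk hfk').ker → Literature.AlgebraicGeometry.Resolution.Scheme.IsRegular (AlgebraicGeometry.Scheme.IdealSheafData.vanishingIdeal (⟨closure (τ₀ ⁻¹' (Set.range j \ ((AlgebraicGeometry.Proj.map fk hfk').ker.support : Set (AlgebraicGeometry.Proj (MvPolynomial.homogeneousSubmodule (Fin (r + m + 1)) k))))), isClosed_closure⟩ : TopologicalSpace.Closeds W)).subscheme) := by
  intro p _ k _ _ _ n H ι hι hH _ hBM
  obtain ⟨𝔞, h𝔞, hreg⟩ := hBM
  obtain ⟨r, m, j, S, hV, hj, hcov, hS⟩ := hre k n H ι hι hH 𝔞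
  haveI := hj
  obtain ⟨fk, hfk', h⟩ := linearCentre_of_charts j h𝔞 hreg S hV hcov hS
  exact ⟨r, m, fk, hfk', j, h⟩

end Assembly

end LinearCentre

end Summit.ResolutionOfSingularities.ResolutionOfSingularities.Cruxes.EquisingularLift.StrataSplit

end
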